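import Literature.NumberTheory.ComplexMultiplication.MainTheoremCMModelReduction
import Literature.NumberTheory.ComplexMultiplication.MainTheoremCMLevelStructure
import Literature.NumberTheory.ComplexMultiplication.MainTheoremCMLevelGluingHolds
import Literature.NumberTheory.ComplexMultiplication.CMDefinedOverQbarHolds
import Literature.NumberTheory.ComplexMultiplication.CMBalancedDivisorFiniteExtensionHolds
import Literature.NumberTheory.ComplexMultiplication.ShimuraTaniyamaPairDegOnePrimeHolds
import Literature.AlgebraicGeometry.Motives.AbelianVarietyGoodReductionHomConjFrobTateHolds
import HarnessLib

/-!
# [Shimura1998] Thm. 18.6 — the MAIN THEOREM OF COMPLEX MULTIPLICATION — holds: the named facts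
# `levelStructure` and `shimura1998_thm18_6` PROVED under their exact names

G. Shimura, *Abelian Varieties with Complex Multiplication and Modular Functions* (Princeton 1998), §18.6 Thm. 18.6
(p. 127; proof pp. 127–130 and 164–169): for a structure `(A, ι)` of type `(K, Φ, 𝔞)` with uniformisation `ξ`,
`σ ∈ Aut(ℂ/K*)` and an idèle `s` of `K*` with `σ = [s, K*]` on `K*_ab`, there is a uniformisation `ξ′` of `(A^σ, ι^σ)` of
type `(K, Φ, g(s)⁻¹𝔞)` with `ξ(q(w))^σ = ξ′(q(g(s)⁻¹w))` — the Literature named fact `shimura1998_thm18_6`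
(`ComplexMultiplication/MainTheoremOfComplexMultiplication`, with its READINGS).  The tree reduces it
(`ComplexMultiplication/MainTheoremCMLevelUniformization`: `shimura1998_thm18_6_of_levelStructure`) to four inputs, all of
which are now Literature theorems:

* S7c `modelReduction_holds` (`MainTheoremCMModelReduction`): reduction to a model `(A₀, ι₀)` over a number field with a
  balanced divisor (§12.4 Prop. 26, §18.6 p. 165);
* row II-2 `shimura1998_prop26_definedOverNumberField_holds` (`CMDefinedOverQbarHolds`) and S5b
  `exists_balancedDivisor_finiteExtension_holds` (`CMBalancedDivisorFiniteExtensionHolds`);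
* S7b `levelGluing_holds` (`MainTheoremCMLevelGluingHolds`): two level uniformisations at levels `N ∣ N'` glue (p. 169);
* S7a — the level-`N` structure `levelStructure` (pp. 164–169 up to (∗∗∗)), obtained by `levelStructure_of_facts_degOne''`
  (`MainTheoremCMLevelStructure`) from row II-2, the UNRAMIFIED degree-one Shimura–Taniyama theorem
  `shimuraTaniyamaPair_degOne'_holds` (`ShimuraTaniyamaPairDegOnePrimeHolds`, §13.1 Thm. 1 (i) at `N𝔭 = p`, `p ∤ d(K)`) and
  the good-reduction/Tate-compatibility fact
  `AbelianVariety.exists_finite_forall_exists_goodReductionAt_homReduction_conjFrob_isTateCompatible_holds`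
  (`Motives/AbelianVarietyGoodReductionHomConjFrobTateHolds`, §11.1 Prop. 12/14 (i) + §18.6 p. 129).

* **`levelStructure_holds`** — S7a, the named fact `levelStructure`, PROVED under its exact name;
* **`shimura1998_thm18_6_holds`** — [Shimura1998] Thm. 18.6, the named fact `shimura1998_thm18_6`, PROVED under its exact
  name, with NO hypothesis (`#print axioms` = {propext, Classical.choice, Quot.sound}).

Theorems only: no definition, no NEW named fact (net: two Literature named facts discharged under their exact names).

Provenance: Literature home of the Summits-side closer `HodgeConjecture/Theorems/HCCMUnconditionalShimuraThm18_6Holds`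
(cell `hodgecm-mathlib`, row II-1: the same two joins, there named `shimura1998_levelStructure_holds` /
`shimura1998_thm18_6_holds` in namespace `Summit.HodgeConjecture.HodgeConjecture.Theorems`), which `Literature/` may not
import; its one Summits-side input `CorCM.Hyp21.factRHS5c_holds` is the Literature theorem
`AbelianVariety.exists_finite_forall_exists_goodReductionAt_homReduction_conjFrob_isTateCompatible_holds`. Lane
`lit-hodgefound`, seat p20.

## References

* [Shimura1998] G. Shimura, *Abelian Varieties with Complex Multiplication and Modular Functions*, Princeton Univ. Press
  1998: §18.6 Thm. 18.6 (p. 127) and its proof (pp. 127–130, 164–169); §13.1 Thm. 1 (i); §13.2; §11.1 Prop. 12,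
  Prop. 14 (i); §12.4 Prop. 26; §6.2 Thm. 4 (3); §4.1 Prop. 10.
* [SerreTate1968] J.-P. Serre, J. Tate, *Good reduction of abelian varieties*, Ann. of Math. 88 (1968), §1 Lemma 2, Thm. 1.
* [Milne2005ShimuraVarieties] J. S. Milne, *Introduction to Shimura varieties* (2005), §11 Thm. 11.2 (Tate-module form).
-/

set_option autoImplicit false

noncomputable section

namespace Literature.NumberTheory.ComplexMultiplication

open Literature.AlgebraicGeometry.Motives

/-- **S7a — the level structure of [Shimura1998] §18.6 HOLDS** (the named fact `levelStructure`, exact name): row II-2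
(`shimura1998_prop26_definedOverNumberField_holds`), the unramified degree-one Shimura–Taniyama theorem
(`shimuraTaniyamaPair_degOne'_holds`, §13.1 Thm. 1 (i) at `N𝔭 = p`, `p ∤ d(K)`) and the good-reduction/Tate-compatibility
fact (`AbelianVariety.exists_finite_forall_exists_goodReductionAt_homReduction_conjFrob_isTateCompatible_holds`: cofinite
produced good-reduction data with Tate-compatible homomorphism reductions to and from the Frobenius conjugate), through
`levelStructure_of_facts_degOne''`.
[cite: Shimura1998, §18.6 proof of Thm. 18.6, pp. 128–130 and 164–169; §13.1 Thm. 1 (i); §11.1 Prop. 12 and Prop. 14 (i)] -/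
theorem levelStructure_holds : levelStructure :=
  levelStructure_of_facts_degOne'' shimura1998_prop26_definedOverNumberField_holds shimuraTaniyamaPair_degOne'_holds
    AbelianVariety.exists_finite_forall_exists_goodReductionAt_homReduction_conjFrob_isTateCompatible_holds

/-- **[Shimura1998] Thm. 18.6 — the Main Theorem of Complex Multiplication — HOLDS, with NO hypothesis** (the named fact
`shimura1998_thm18_6`, exact name): S7c `modelReduction_holds` at row II-2 `shimura1998_prop26_definedOverNumberField_holds`,
S5b `exists_balancedDivisor_finiteExtension_holds`, S7a `levelStructure_holds` and S7b `levelGluing_holds`, joined by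
`shimura1998_thm18_6_of_levelStructure`.
[cite: Shimura1998, §18.6 Thm. 18.6 p. 127, proof pp. 127–130 and 164–169] -/
theorem shimura1998_thm18_6_holds : shimura1998_thm18_6 :=
  shimura1998_thm18_6_of_levelStructure modelReduction_holds shimura1998_prop26_definedOverNumberField_holds
    exists_balancedDivisor_finiteExtension_holds levelStructure_holds levelGluing_holds

end Literature.NumberTheory.ComplexMultiplication

end
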